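import Summits.Ventures.QEC.Thresholds.ToricCodeHGPPhenomTransport
import HarnessLib

/-!
# MWPM rows for the census toric object `HGP(circ_L, circ_L)`: its sectors are GRAPHLIKE (transported lattice ends), so every
# (space-time) matching decoder family is minimum-weight — `p_c^{MWPM} > .0357` both sectors, `> .0535` depolarizing,
# `> .0112` phenomenological both records, three-rate `p ≤ .0168`, `q ≤ .0112` — UNCONDITIONAL, kernel

Venture QEC, `Summits/Ventures/QEC/Thresholds/` (LADDER-QEC rung Q5 «toric/surface + MWPM», CENSUS-PREREG cell B.0; qec-type-09 gen 5,
item TORHGP-TRANSPORT III). The check matrices of `toricHGPCode k` are the lattice star / plaquette matrices re-indexed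
(qec-type-03, `toricHGPCode_eq_reindex`), and those are incidence matrices of the lattice ends maps `starEnds`, `plaqEnds`
(`ToricCodeMatching.lean`). Re-indexing an incidence matrix gives the incidence matrix of the transported ends map
(`reindex_incMatrix_eq`), so `H^X`, `H^Z` of the HGP object are `incMatrix` of explicit ends maps (`toricHGPCode_HX_eq_incMatrix`,
`toricHGPCode_HZ_eq_incMatrix`). Consequently Korte–Vygen Thm 12.9 (`IsMatchingDecoder.isMinWeight`; in space-time
`CSSPhenom.isMinWeight_of_isMatchingDecoder_stEnds`) makes every (space-time) MWPM decoder of either sector minimum-weight, and the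
transfer theorems of `ToricCodeHGPThresholdsTransport.lean` / `ToricCodeHGPPhenomTransport.lean` yield the MWPM rows of the census
object (same kernel decimals as the lattice object):

| theorem | statement |
|---|---|
| `toricHGP_isMinWeight_of_isMatchingDecoder_z/_x`, `…_stZ/_stX` | MWPM (code capacity / space-time) decoders of the HGP object's sectors are minimum-weight |
| `toricHGP_z_mwpm_accuracyThreshold_gt_0357`, `toricHGP_x_mwpm_accuracyThreshold_gt_0357` | **`p_c^{MWPM} > .0357`**, both sectors |
| `toricHGP_depolarizing_mwpm_accuracyThreshold_gt_0535` | sector-wise MWPM under depolarizing noise: **`> .0535`** |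
| `toricHGP_z_phenom_mwpm_accuracyThreshold_gt_0112`, `toricHGP_x_phenom_mwpm_accuracyThreshold_gt_0112` | space-time MWPM, `q = p`, poly `T`: **`> .0112`** both records |
| `toricHGP_depolPhenom_mwpm_belowThreshold_0168_0112` | three-rate phenomenological depolarizing, space-time MWPM on both records: `p ≤ .0168`, `q_X, q_Z ≤ .0112` ⇒ `P_fail → 0` |
| `exists_toricHGP_mwpm_family_accuracyThreshold_gt_0357`, `exists_toricHGP_st_mwpm_family_accuracyThreshold_gt_0112` | non-vacuity (extended chain metrics) |

All UNCONDITIONAL, tier CERTIFIED (kernel), axioms standard, 0 named facts. Theorem-only file.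

## References

* [KorteVygen2002] B. Korte, J. Vygen, *Combinatorial Optimization* (2002), §12.2 Thm 12.9.
* [DennisEtAl2002] E. Dennis, A. Kitaev, A. Landahl, J. Preskill, J. Math. Phys. 43 (2002) 4452, §4.4 p. 18, §5.1 p. 19, §5.3.
* [KovalevPryadko2012] A. A. Kovalev, L. P. Pryadko, arXiv:1202.0928, Examples 2 and 6.
* [AliferisGottesmanPreskill2006] P. Aliferis, D. Gottesman, J. Preskill, arXiv:quant-ph/0504218, §8.2 (chunk p0026 L11).
-/

noncomputable section

namespace Summit.Ventures.QEC.Thresholds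

open Filter Topology Finset Matrix
open Literature.InformationTheory.QuantumCodes
open Literature.InformationTheory.QuantumCodes.ToricCode
open Literature.Probability.RandomPlanarGeometry

/-! ### Re-indexed incidence matrices are incidence matrices -/

/-- **A re-indexed incidence matrix is the incidence matrix of the transported ends map**:
`reindex eC eQ (incMatrix ends) = incMatrix (q' ↦ (ends (eQ⁻¹ q')).map eC)`. [cite: KorteVygen2002, §12.2 Def 12.5] -/
theorem reindex_incMatrix_eq {V E V' E' : Type*} [DecidableEq V] [DecidableEq V'] (ends : E → Sym2 V) (eC : V ≃ V')
    (eQ : E ≃ E') :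
    Matrix.reindex eC eQ (incMatrix ends) = incMatrix fun q' => (ends (eQ.symm q')).map ⇑eC := by
  ext c' q'
  simp only [Matrix.reindex_apply, Matrix.submatrix_apply, incMatrix, of_apply]
  induction (ends (eQ.symm q')) using Sym2.ind with
  | h a b =>
    simp only [Sym2.map_mk, pairIndicator_mk, Pi.add_apply, Pi.single_apply, Equiv.symm_apply_eq]

/-- **`H^X` of the census toric object is an incidence matrix** (transported star ends).
[cite: KovalevPryadko2012, Examples 2 and 6] [cite: DennisEtAl2002, §3.1] -/
theorem toricHGPCode_HX_eq_incMatrix (k : ℕ) :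
    (toricHGPCode k).HX =
      incMatrix fun q => (starEnds (k + 2) ((toricQubitEquiv k).symm.symm q)).map ⇑(toricVertexEquiv k).symm := by
  rw [toricHGPCode_eq_reindex, CSSCode.reindex_HX]
  change Matrix.reindex _ _ (starMatrix (k + 2)) = _
  rw [starMatrix_eq_incMatrix, reindex_incMatrix_eq]

/-- **`H^Z` of the census toric object is an incidence matrix** (transported plaquette ends).
[cite: KovalevPryadko2012, Examples 2 and 6] [cite: DennisEtAl2002, §3.1] -/
theorem toricHGPCode_HZ_eq_incMatrix (k : ℕ) :
    (toricHGPCode k).HZ =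
      incMatrix fun q => (plaqEnds (k + 2) ((toricQubitEquiv k).symm.symm q)).map ⇑(toricVertexEquiv k).symm := by
  rw [toricHGPCode_eq_reindex, CSSCode.reindex_HZ]
  change Matrix.reindex _ _ (plaquetteMatrix (k + 2)) = _
  rw [plaquetteMatrix_eq_incMatrix, reindex_incMatrix_eq]

/-! ### Matching decoders of the HGP object are minimum-weight -/

/-- **Code capacity, `Z` sector**: every matching decoder (any link metric on the `X` checks) of `HGP(circ_L, circ_L)` is a
minimum-weight decoder for `zSyndrome` w.r.t. `ker H^X`. [cite: KorteVygen2002, §12.2 Thm 12.9] [cite: DennisEtAl2002, §4.4 p. 18] -/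
theorem toricHGP_isMinWeight_of_isMatchingDecoder_z (k : ℕ)
    {m : EdgeMetric (fun q => (starEnds (k + 2) ((toricQubitEquiv k).symm.symm q)).map ⇑(toricVertexEquiv k).symm)}
    {D : Decoder ((Fin (k + 2) × Fin (k + 2)) → ZMod 2) (((Fin (k + 2) × Fin (k + 2)) ⊕ (Fin (k + 2) × Fin (k + 2))) → ZMod 2)}
    (hD : IsMatchingDecoder m D) :
    D.IsMinWeight (toricHGPCode k).zSyndrome ((toricHGPCode k).kerX : Set _) hammingNorm := by
  have h := hD.isMinWeight
  have hsyn : (toricHGPCode k).zSyndrome =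
      graphSyn (fun q => (starEnds (k + 2) ((toricQubitEquiv k).symm.symm q)).map ⇑(toricVertexEquiv k).symm) := by
    funext e
    change (toricHGPCode k).HX *ᵥ e = _
    rw [toricHGPCode_HX_eq_incMatrix]
    rfl
  refine ⟨fun e => ?_, fun e => ?_⟩
  · have h1 := h.add_mem e
    rw [SetLike.mem_coe, CSSCode.mem_kerX_iff, toricHGPCode_HX_eq_incMatrix, hsyn]
    exact h1
  · have h2 := h.weight_le e
    rw [hsyn]
    exact h2

/-- **Code capacity, `X` sector**: every matching decoder of the `Z`-check syndrome of `HGP(circ_L, circ_L)` is minimum-weight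
for `xSyndrome` w.r.t. `ker H^Z`. [cite: KorteVygen2002, §12.2 Thm 12.9] [cite: DennisEtAl2002, §4.4 p. 18] -/
theorem toricHGP_isMinWeight_of_isMatchingDecoder_x (k : ℕ)
    {m : EdgeMetric (fun q => (plaqEnds (k + 2) ((toricQubitEquiv k).symm.symm q)).map ⇑(toricVertexEquiv k).symm)}
    {D : Decoder ((Fin (k + 2) × Fin (k + 2)) → ZMod 2) (((Fin (k + 2) × Fin (k + 2)) ⊕ (Fin (k + 2) × Fin (k + 2))) → ZMod 2)}
    (hD : IsMatchingDecoder m D) :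
    D.IsMinWeight (toricHGPCode k).xSyndrome ((toricHGPCode k).kerZ : Set _) hammingNorm := by
  have h := hD.isMinWeight
  have hsyn : (toricHGPCode k).xSyndrome =
      graphSyn (fun q => (plaqEnds (k + 2) ((toricQubitEquiv k).symm.symm q)).map ⇑(toricVertexEquiv k).symm) := by
    funext e
    change (toricHGPCode k).HZ *ᵥ e = _
    rw [toricHGPCode_HZ_eq_incMatrix]
    rfl
  refine ⟨fun e => ?_, fun e => ?_⟩
  · have h1 := h.add_mem e
    rw [SetLike.mem_coe, CSSCode.mem_kerZ_iff, toricHGPCode_HZ_eq_incMatrix, hsyn]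
    exact h1
  · have h2 := h.weight_le e
    rw [hsyn]
    exact h2

/-- **Space-time, star record**: every space-time matching decoder of the HGP object's `X`-check record (ends `CSSPhenom.stEnds`
of the transported star ends) is a minimum-weight space-time decoder. [cite: KorteVygen2002, §12.2 Thm 12.9] [cite: DennisEtAl2002, §5.1 p. 19] -/
theorem toricHGP_isMinWeight_of_isMatchingDecoder_stZ (k T : ℕ)
    {m : EdgeMetric (CSSPhenom.stEnds
      (fun q => (starEnds (k + 2) ((toricQubitEquiv k).symm.symm q)).map ⇑(toricVertexEquiv k).symm) T)}
    {D : CSSPhenom.STDecoder (Fin (k + 2) × Fin (k + 2)) ((Fin (k + 2) × Fin (k + 2)) ⊕ (Fin (k + 2) × Fin (k + 2))) T}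
    (hD : IsMatchingDecoder m D) :
    D.IsMinWeight (CSSPhenom.stSyn (toricHGPCode k).HX T) (CSSPhenom.stCycles (toricHGPCode k).HX T) hammingNorm := by
  rw [toricHGPCode_HX_eq_incMatrix]
  exact CSSPhenom.isMinWeight_of_isMatchingDecoder_stEnds hD

/-- **Space-time, plaquette record**: every space-time matching decoder of the HGP object's `Z`-check record is a minimum-weight
space-time decoder. [cite: KorteVygen2002, §12.2 Thm 12.9] [cite: DennisEtAl2002, §5.1 p. 19] -/
theorem toricHGP_isMinWeight_of_isMatchingDecoder_stX (k T : ℕ)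
    {m : EdgeMetric (CSSPhenom.stEnds
      (fun q => (plaqEnds (k + 2) ((toricQubitEquiv k).symm.symm q)).map ⇑(toricVertexEquiv k).symm) T)}
    {D : CSSPhenom.STDecoder (Fin (k + 2) × Fin (k + 2)) ((Fin (k + 2) × Fin (k + 2)) ⊕ (Fin (k + 2) × Fin (k + 2))) T}
    (hD : IsMatchingDecoder m D) :
    D.IsMinWeight (CSSPhenom.stSyn (toricHGPCode k).HZ T) (CSSPhenom.stCycles (toricHGPCode k).HZ T) hammingNorm := by
  rw [toricHGPCode_HZ_eq_incMatrix]
  exact CSSPhenom.isMinWeight_of_isMatchingDecoder_stEnds hD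

/-! ### MWPM rows: code capacity and depolarizing noise -/

/-- **`p_c^{Z,MWPM} > .0357` for `HGP(circ_L, circ_L)`**, every MWPM decoder family of the `X`-check syndrome — UNCONDITIONAL, kernel.
[cite: DennisEtAl2002, §4.4 p. 18 and §5.3 eq. (p_c_2d)] -/
theorem toricHGP_z_mwpm_accuracyThreshold_gt_0357
    (m : ∀ k, EdgeMetric (fun q => (starEnds (k + 2) ((toricQubitEquiv k).symm.symm q)).map ⇑(toricVertexEquiv k).symm))
    {D : ∀ k, Decoder ((Fin (k + 2) × Fin (k + 2)) → ZMod 2)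
      (((Fin (k + 2) × Fin (k + 2)) ⊕ (Fin (k + 2) × Fin (k + 2))) → ZMod 2)}
    (hD : ∀ k, IsMatchingDecoder (m k) (D k)) :
    (0.0357 : ℝ) < accuracyThreshold (zFailureFamily (fun k => toricHGPCode k) D) :=
  toricHGP_z_accuracyThreshold_gt_0357 D fun k => toricHGP_isMinWeight_of_isMatchingDecoder_z k (hD k)

/-- **`p_c^{X,MWPM} > .0357` for `HGP(circ_L, circ_L)`**, every MWPM decoder family of the `Z`-check syndrome — UNCONDITIONAL, kernel.
[cite: DennisEtAl2002, §4.4 p. 18 and §5.3 eq. (p_c_2d)] -/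
theorem toricHGP_x_mwpm_accuracyThreshold_gt_0357
    (m : ∀ k, EdgeMetric (fun q => (plaqEnds (k + 2) ((toricQubitEquiv k).symm.symm q)).map ⇑(toricVertexEquiv k).symm))
    {DX : ∀ k, Decoder ((Fin (k + 2) × Fin (k + 2)) → ZMod 2)
      (((Fin (k + 2) × Fin (k + 2)) ⊕ (Fin (k + 2) × Fin (k + 2))) → ZMod 2)}
    (hDX : ∀ k, IsMatchingDecoder (m k) (DX k)) :
    (0.0357 : ℝ) < accuracyThreshold (xFailureFamily (fun k => toricHGPCode k) DX) :=
  toricHGP_x_accuracyThreshold_gt_0357 DX fun k => toricHGP_isMinWeight_of_isMatchingDecoder_x k (hDX k)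

/-- **`p_c^{depol,MWPM} > .0535` for `HGP(circ_L, circ_L)`**, sector-wise MWPM decoding — UNCONDITIONAL, kernel.
[cite: AliferisGottesmanPreskill2006, §8.2 (chunk p0026 L11)] [cite: DennisEtAl2002, §5.3 eq. (p_c_2d)] -/
theorem toricHGP_depolarizing_mwpm_accuracyThreshold_gt_0535
    (mX : ∀ k, EdgeMetric (fun q => (plaqEnds (k + 2) ((toricQubitEquiv k).symm.symm q)).map ⇑(toricVertexEquiv k).symm))
    (mZ : ∀ k, EdgeMetric (fun q => (starEnds (k + 2) ((toricQubitEquiv k).symm.symm q)).map ⇑(toricVertexEquiv k).symm))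
    {DX DZ : ∀ k, Decoder ((Fin (k + 2) × Fin (k + 2)) → ZMod 2)
      (((Fin (k + 2) × Fin (k + 2)) ⊕ (Fin (k + 2) × Fin (k + 2))) → ZMod 2)}
    (hDX : ∀ k, IsMatchingDecoder (mX k) (DX k)) (hDZ : ∀ k, IsMatchingDecoder (mZ k) (DZ k)) :
    (0.0535 : ℝ) < accuracyThreshold (depolarizingFailureFamily (fun k => toricHGPCode k) DX DZ) :=
  toricHGP_depolarizing_accuracyThreshold_gt_0535 DX DZ (fun k => toricHGP_isMinWeight_of_isMatchingDecoder_x k (hDX k))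
    fun k => toricHGP_isMinWeight_of_isMatchingDecoder_z k (hDZ k)

/-- **Non-vacuity** (code capacity, `Z` sector): an MWPM family of the HGP object exists (extended chain metric) and its certified
threshold exceeds `.0357`. [cite: KorteVygen2002, §12.2 Thm 12.9] -/
theorem exists_toricHGP_mwpm_family_accuracyThreshold_gt_0357 :
    ∃ D : ∀ k, Decoder ((Fin (k + 2) × Fin (k + 2)) → ZMod 2)
        (((Fin (k + 2) × Fin (k + 2)) ⊕ (Fin (k + 2) × Fin (k + 2))) → ZMod 2),
      (∀ k, IsMatchingDecoder
        (extMetric (fun q => (starEnds (k + 2) ((toricQubitEquiv k).symm.symm q)).map ⇑(toricVertexEquiv k).symm)) (D k)) ∧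
      (0.0357 : ℝ) < accuracyThreshold (zFailureFamily (fun k => toricHGPCode k) D) := by
  choose D hD using fun k => exists_isMatchingDecoder_extMetric
    (ι := fun q => (starEnds (k + 2) ((toricQubitEquiv k).symm.symm q)).map ⇑(toricVertexEquiv k).symm)
  exact ⟨D, hD, toricHGP_z_mwpm_accuracyThreshold_gt_0357 _ hD⟩

/-! ### MWPM rows: noisy measurement -/

/-- **`p_c^{Z,ph,MWPM} > .0112` for `HGP(circ_L, circ_L)`** (star record, space-time MWPM, poly `T`) — UNCONDITIONAL, kernel.
[cite: DennisEtAl2002, §5.1 p. 19 and §5.3 eq. (threshold_iso_num)] -/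
theorem toricHGP_z_phenom_mwpm_accuracyThreshold_gt_0112 {T : ℕ → ℕ} (hT : IsPolyBounded T)
    (m : ∀ k, EdgeMetric (CSSPhenom.stEnds
      (fun q => (starEnds (k + 2) ((toricQubitEquiv k).symm.symm q)).map ⇑(toricVertexEquiv k).symm) (T k)))
    {D : ∀ k, CSSPhenom.STDecoder (Fin (k + 2) × Fin (k + 2))
      ((Fin (k + 2) × Fin (k + 2)) ⊕ (Fin (k + 2) × Fin (k + 2))) (T k)}
    (hD : ∀ k, IsMatchingDecoder (m k) (D k)) :
    (0.0112 : ℝ) < accuracyThreshold (zPhenomFailureFamily (fun k => toricHGPCode k) T D) :=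
  toricHGP_z_phenom_accuracyThreshold_gt_0112 hT D fun k => toricHGP_isMinWeight_of_isMatchingDecoder_stZ k (T k) (hD k)

/-- **`p_c^{X,ph,MWPM} > .0112` for `HGP(circ_L, circ_L)`** (plaquette record, space-time MWPM, poly `T`) — UNCONDITIONAL, kernel.
[cite: DennisEtAl2002, §5.1 p. 19 and §5.3 eq. (threshold_iso_num)] -/
theorem toricHGP_x_phenom_mwpm_accuracyThreshold_gt_0112 {T : ℕ → ℕ} (hT : IsPolyBounded T)
    (m : ∀ k, EdgeMetric (CSSPhenom.stEnds
      (fun q => (plaqEnds (k + 2) ((toricQubitEquiv k).symm.symm q)).map ⇑(toricVertexEquiv k).symm) (T k)))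
    {DX : ∀ k, CSSPhenom.STDecoder (Fin (k + 2) × Fin (k + 2))
      ((Fin (k + 2) × Fin (k + 2)) ⊕ (Fin (k + 2) × Fin (k + 2))) (T k)}
    (hDX : ∀ k, IsMatchingDecoder (m k) (DX k)) :
    (0.0112 : ℝ) < accuracyThreshold (xPhenomFailureFamily (fun k => toricHGPCode k) T DX) :=
  toricHGP_x_phenom_accuracyThreshold_gt_0112 hT DX fun k => toricHGP_isMinWeight_of_isMatchingDecoder_stX k (T k) (hDX k)

/-- **Three-rate phenomenological depolarizing noise, space-time MWPM on both records of `HGP(circ_L, circ_L)`: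
`p ≤ .0168`, `q_X, q_Z ≤ .0112` ⇒ `P_fail → 0`** (poly `T`) — UNCONDITIONAL, kernel.
[cite: AliferisGottesmanPreskill2006, §8.2 (chunk p0026 L11)] [cite: DennisEtAl2002, §5.3 eq. (threshold_iso_num)] -/
theorem toricHGP_depolPhenom_mwpm_belowThreshold_0168_0112 {T : ℕ → ℕ} (hT : IsPolyBounded T)
    (mZ : ∀ k, EdgeMetric (CSSPhenom.stEnds
      (fun q => (starEnds (k + 2) ((toricQubitEquiv k).symm.symm q)).map ⇑(toricVertexEquiv k).symm) (T k)))
    (mX : ∀ k, EdgeMetric (CSSPhenom.stEnds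
      (fun q => (plaqEnds (k + 2) ((toricQubitEquiv k).symm.symm q)).map ⇑(toricVertexEquiv k).symm) (T k)))
    {DZ DX : ∀ k, CSSPhenom.STDecoder (Fin (k + 2) × Fin (k + 2))
      ((Fin (k + 2) × Fin (k + 2)) ⊕ (Fin (k + 2) × Fin (k + 2))) (T k)}
    (hDZ : ∀ k, IsMatchingDecoder (mZ k) (DZ k)) (hDX : ∀ k, IsMatchingDecoder (mX k) (DX k))
    {p qX qZ : ℝ} (hp0 : 0 ≤ p) (hp : p ≤ 0.0168) (hqX0 : 0 ≤ qX) (hqX : qX ≤ 0.0112) (hqZ0 : 0 ≤ qZ)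
    (hqZ : qZ ≤ 0.0112) :
    Tendsto (fun k => (toricHGPCode k).depolPhenomFailureProb (T k) (DZ k) (DX k) p qX qZ) atTop (𝓝 0) :=
  toricHGP_depolPhenom_belowThreshold_0168_0112 hT DZ DX
    (fun k => toricHGP_isMinWeight_of_isMatchingDecoder_stZ k (T k) (hDZ k))
    (fun k => toricHGP_isMinWeight_of_isMatchingDecoder_stX k (T k) (hDX k)) hp0 hp hqX0 hqX hqZ0 hqZ

/-- **Non-vacuity** (space-time, star record, `T(k) = k + 1`): a space-time MWPM family of the HGP object exists and its
certified phenomenological threshold exceeds `.0112`. [cite: KorteVygen2002, §12.2 Thm 12.9] -/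
theorem exists_toricHGP_st_mwpm_family_accuracyThreshold_gt_0112 :
    ∃ D : ∀ k, CSSPhenom.STDecoder (Fin (k + 2) × Fin (k + 2))
        ((Fin (k + 2) × Fin (k + 2)) ⊕ (Fin (k + 2) × Fin (k + 2))) (k + 1),
      (∀ k, IsMatchingDecoder (extMetric (CSSPhenom.stEnds
        (fun q => (starEnds (k + 2) ((toricQubitEquiv k).symm.symm q)).map ⇑(toricVertexEquiv k).symm) (k + 1))) (D k)) ∧
      (0.0112 : ℝ) < accuracyThreshold (zPhenomFailureFamily (fun k => toricHGPCode k) (fun k => k + 1) D) := by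
  choose D hD using fun k => CSSPhenom.exists_isMatchingDecoder_stEnds
    (fun q => (starEnds (k + 2) ((toricQubitEquiv k).symm.symm q)).map ⇑(toricVertexEquiv k).symm) (k + 1)
  exact ⟨D, hD, toricHGP_z_phenom_mwpm_accuracyThreshold_gt_0112 isPolyBounded_succ _ hD⟩

end Summit.Ventures.QEC.Thresholds

end
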